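import Summits.Ventures.PercRepro.ProfilePointedCircuitClassesStarSharpDefectB

/-!
# PercRepro — THE DEFECT COUNT OF `StarNineSharp`, PART C: THREE DEFECTS, THREE TARGETS
(p5, gen 55; `proofs/P5-GM1.md` §82 ADD 3–4)

`three_targets_of_three_bad_P`: three distinct defects of a demand class `P` (no swap in `R`) give three targets
`{e, f, x} + b` in `T`; `card_bad_le_targets_of_card_le_three_P`: at most three defects are at most the targets.
The regimes instantiate `P` and `T`: the loop regime (LoopG), `b ∥ e` and `b ∥ f` (ParA).
-/

open scoped Matroid

namespace PercRepro.Cogirth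

open Finset ThmH Skew Shadow Profile

open Classical

variable {α : Type} [DecidableEq α] {N : Matroid α} [N.Finite]

section StarSharpDefectC

variable {b b' : α}


/-- **THREE TARGETS FROM A SHARED C-ENDPOINT, `u ∈ C`**: defects `{c, u}`, `{c, v}` (`c, u ∈ C`) and a third defect
with a C-endpoint `x₃`. -/
theorem three_targets_of_shared_uC (hn : (gr N).card = 9) (h : SeriesPair N b b')
    {e f : α} (he : e ∈ gr N) (hf : f ∈ gr N) (hef : e ≠ f) (heb : e ≠ b) (heb' : e ≠ b') (hfb : f ≠ b) (hfb' : f ≠ b')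
    (he1 : ∀ y ∈ ((((gr N).erase b).erase b').erase f).erase e, rk N {e, y} = 2)
    (hf1 : ∀ y ∈ ((((gr N).erase b).erase b').erase f).erase e, rk N {f, y} = 2)
    (hfc : ∀ y ∈ ((((gr N).erase b).erase b').erase f).erase e, rk N (((((gr N).erase b).erase b').erase f).erase y) = 4)
    (hX : rk N (((((gr N).erase b).erase b').erase f).erase e) = 4) (hef2 : rk N {e, f} = 2)
    {P : Finset α → Prop} [DecidablePred P] {T : Finset (Finset α)}
    (hP : ∀ W ∈ (d0DON N b' e f).filter P, ¬ (rk N (insert f ((W.erase b).erase e)) = 3 ∧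
      rk N (insert e (((((gr N).erase b).erase b').erase f).erase e \ (W.erase b).erase e)) = 4))
    (htgt : ∀ x ∈ ((((gr N).erase b).erase b').erase f).erase e, rk N {e, f, x} = 3 →
      rk N ((((((gr N).erase b).erase b').erase f).erase e).erase x) = 4 → insert b {e, f, x} ∈ T)
    {W₁ W₂ W₃ : Finset α} (hW₁ : W₁ ∈ (d0DON N b' e f).filter P)
    (hW₂ : W₂ ∈ (d0DON N b' e f).filter P)
    (hW₃ : W₃ ∈ (d0DON N b' e f).filter P)
    (hW13 : W₁ ≠ W₃) (hW23 : W₂ ≠ W₃)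
    {c u v : α} (hπ₁ : (W₁.erase b).erase e = {c, u}) (hπ₂ : (W₂.erase b).erase e = {c, v})
    (hcu : c ≠ u) (hcv : c ≠ v) (huv : u ≠ v)
    (hcC : rk N {e, f, c} = 3 ∧ rk N ((((((gr N).erase b).erase b').erase f).erase e).erase c) = 4)
    (huC : rk N {e, f, u} = 3 ∧ rk N ((((((gr N).erase b).erase b').erase f).erase e).erase u) = 4)
    {x₃ : α} (hx₃π : x₃ ∈ (W₃.erase b).erase e)
    (hx₃C : rk N {e, f, x₃} = 3 ∧ rk N ((((((gr N).erase b).erase b').erase f).erase e).erase x₃) = 4) :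
    3 ≤ T.card := by
  have hbadC := defect_data_of_P hn h he hf hef heb heb' hfb hfb' he1 hf1 hX hef2 hP
  obtain ⟨hπX₁, -, hWeq₁, -, -, -, -⟩ := hbadC W₁ hW₁
  obtain ⟨hπX₂, -, hWeq₂, -, -, -, -⟩ := hbadC W₂ hW₂
  obtain ⟨hπX₃, hπ2₃, hWeq₃, -, -, -, -⟩ := hbadC W₃ hW₃
  have hcX : c ∈ ((((gr N).erase b).erase b').erase f).erase e := by rw [hπ₁] at hπX₁; exact hπX₁ (mem_insert_self _ _)
  have huX : u ∈ ((((gr N).erase b).erase b').erase f).erase e := by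
    rw [hπ₁] at hπX₁; exact hπX₁ (mem_insert_of_mem (mem_singleton_self _))
  have hvX : v ∈ ((((gr N).erase b).erase b').erase f).erase e := by
    rw [hπ₂] at hπX₂; exact hπX₂ (mem_insert_of_mem (mem_singleton_self _))
  have hx₃X := hπX₃ hx₃π
  -- the pair of `W₃` differs from the pairs of `W₁`, `W₂`
  have hπ13 : (W₃.erase b).erase e ≠ {c, u} := by
    intro h'; apply hW13; rw [← hWeq₁, ← hWeq₃, h', hπ₁]
  have hπ23 : (W₃.erase b).erase e ≠ {c, v} := by
    intro h'; apply hW23; rw [← hWeq₂, ← hWeq₃, h', hπ₂]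
  by_cases hv : rk N {e, f, v} = 3 ∧ rk N ((((((gr N).erase b).erase b').erase f).erase e).erase v) = 4
  · exact three_le_card_targets_of_P htgt hcu hcv huv hcX huX hvX hcC.1 hcC.2
      huC.1 huC.2 hv.1 hv.2
  by_cases h3c : x₃ = c
  · subst h3c
    obtain ⟨w, hwc, hwπ, hπ₃⟩ := pair_of_defect hπ2₃ hx₃π
    have hwX := hπX₃ hwπ
    have hwu : w ≠ u := fun h' => hπ13 (by rw [hπ₃, h'])
    have hwv : w ≠ v := fun h' => hπ23 (by rw [hπ₃, h'])
    by_cases hw : rk N {e, f, w} = 3 ∧ rk N ((((((gr N).erase b).erase b').erase f).erase e).erase w) = 4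
    · exact three_le_card_targets_of_P htgt hcu hwc.symm hwu.symm hcX huX hwX
        hcC.1 hcC.2 huC.1 huC.2 hw.1 hw.2
    · obtain ⟨p, q, hpq, hpc, hqc, hpX, hqX, hpC, hqC⟩ := two_more_cpoints_of_P hn h he hf hef heb heb' hfb hfb'
        he1 hf1 hfc hX hef2 hP hW₂ hW₃ hπ₂ hπ₃ hcv hwc.symm hwv.symm hv hw
      exact three_le_card_targets_of_P htgt hpc.symm hqc.symm hpq hcX hpX hqX
        hcC.1 hcC.2 hpC.1 hpC.2 hqC.1 hqC.2
  by_cases h3u : x₃ = u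
  · subst h3u
    obtain ⟨w, hwu, hwπ, hπ₃⟩ := pair_of_defect hπ2₃ hx₃π
    have hwX := hπX₃ hwπ
    have hwc : w ≠ c := fun h' => hπ13 (by rw [hπ₃, h', pair_comm'])
    by_cases hwv : w = v
    · subst hwv
      exact absurd (not_triangle_bad_of_P hn h he hf hef heb heb' hfb hfb' he1 hf1 hfc hX hef2 hP hW₁ hW₂ hW₃
        hπ₁ hπ₂ hπ₃ hcu hcv huv hv) id
    by_cases hw : rk N {e, f, w} = 3 ∧ rk N ((((((gr N).erase b).erase b').erase f).erase e).erase w) = 4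
    · exact three_le_card_targets_of_P htgt hcu hwc.symm hwu.symm hcX huX hwX
        hcC.1 hcC.2 huC.1 huC.2 hw.1 hw.2
    · exact absurd (not_path_bad_of_P hn h he hf hef heb heb' hfb hfb' he1 hf1 hfc hX hef2 hP hW₁ hW₂ hW₃
        hπ₁ hπ₂ hπ₃ hcu hcv hwc.symm huv hwu.symm (Ne.symm hwv) hv hw) id
  · exact three_le_card_targets_of_P htgt hcu (Ne.symm h3c) (Ne.symm h3u) hcX huX
      hx₃X hcC.1 hcC.2 huC.1 huC.2 hx₃C.1 hx₃C.2

/-- **THREE TARGETS FROM A SHARED C-ENDPOINT**: defects `{c, u}`, `{c, v}` (`c ∈ C`) and a third defect with a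
C-endpoint. -/
theorem three_targets_of_shared (hn : (gr N).card = 9) (h : SeriesPair N b b')
    {e f : α} (he : e ∈ gr N) (hf : f ∈ gr N) (hef : e ≠ f) (heb : e ≠ b) (heb' : e ≠ b') (hfb : f ≠ b) (hfb' : f ≠ b')
    (he1 : ∀ y ∈ ((((gr N).erase b).erase b').erase f).erase e, rk N {e, y} = 2)
    (hf1 : ∀ y ∈ ((((gr N).erase b).erase b').erase f).erase e, rk N {f, y} = 2)
    (hfc : ∀ y ∈ ((((gr N).erase b).erase b').erase f).erase e, rk N (((((gr N).erase b).erase b').erase f).erase y) = 4)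
    (hX : rk N (((((gr N).erase b).erase b').erase f).erase e) = 4) (hef2 : rk N {e, f} = 2)
    {P : Finset α → Prop} [DecidablePred P] {T : Finset (Finset α)}
    (hP : ∀ W ∈ (d0DON N b' e f).filter P, ¬ (rk N (insert f ((W.erase b).erase e)) = 3 ∧
      rk N (insert e (((((gr N).erase b).erase b').erase f).erase e \ (W.erase b).erase e)) = 4))
    (htgt : ∀ x ∈ ((((gr N).erase b).erase b').erase f).erase e, rk N {e, f, x} = 3 →
      rk N ((((((gr N).erase b).erase b').erase f).erase e).erase x) = 4 → insert b {e, f, x} ∈ T)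
    {W₁ W₂ W₃ : Finset α} (hW₁ : W₁ ∈ (d0DON N b' e f).filter P)
    (hW₂ : W₂ ∈ (d0DON N b' e f).filter P)
    (hW₃ : W₃ ∈ (d0DON N b' e f).filter P)
    (hW12 : W₁ ≠ W₂) (hW13 : W₁ ≠ W₃) (hW23 : W₂ ≠ W₃)
    {c : α} (hc₁ : c ∈ (W₁.erase b).erase e) (hc₂ : c ∈ (W₂.erase b).erase e)
    (hcC : rk N {e, f, c} = 3 ∧ rk N ((((((gr N).erase b).erase b').erase f).erase e).erase c) = 4)
    {x₃ : α} (hx₃π : x₃ ∈ (W₃.erase b).erase e)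
    (hx₃C : rk N {e, f, x₃} = 3 ∧ rk N ((((((gr N).erase b).erase b').erase f).erase e).erase x₃) = 4) :
    3 ≤ T.card := by
  have hbadC := defect_data_of_P hn h he hf hef heb heb' hfb hfb' he1 hf1 hX hef2 hP
  obtain ⟨hπX₁, hπ2₁, hWeq₁, -, -, -, -⟩ := hbadC W₁ hW₁
  obtain ⟨hπX₂, hπ2₂, hWeq₂, -, -, -, -⟩ := hbadC W₂ hW₂
  obtain ⟨u, huc, huπ, hπ₁⟩ := pair_of_defect hπ2₁ hc₁
  obtain ⟨v, hvc, hvπ, hπ₂⟩ := pair_of_defect hπ2₂ hc₂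
  have huv : u ≠ v := by
    intro h'; apply hW12; rw [← hWeq₁, ← hWeq₂, hπ₁, hπ₂, h']
  have hcX := hπX₁ hc₁
  by_cases hu : rk N {e, f, u} = 3 ∧ rk N ((((((gr N).erase b).erase b').erase f).erase e).erase u) = 4
  · exact three_targets_of_shared_uC hn h he hf hef heb heb' hfb hfb' he1 hf1 hfc hX hef2 hP htgt hW₁ hW₂ hW₃ hW13 hW23
      hπ₁ hπ₂ huc.symm hvc.symm huv hcC hu hx₃π hx₃C
  by_cases hv : rk N {e, f, v} = 3 ∧ rk N ((((((gr N).erase b).erase b').erase f).erase e).erase v) = 4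
  · exact three_targets_of_shared_uC hn h he hf hef heb heb' hfb hfb' he1 hf1 hfc hX hef2 hP htgt hW₂ hW₁ hW₃ hW23 hW13
      hπ₂ hπ₁ hvc.symm huc.symm huv.symm hcC hv hx₃π hx₃C
  obtain ⟨p, q, hpq, hpc, hqc, hpX, hqX, hpC, hqC⟩ := two_more_cpoints_of_P hn h he hf hef heb heb' hfb hfb'
    he1 hf1 hfc hX hef2 hP hW₁ hW₂ hπ₁ hπ₂ huc.symm hvc.symm huv hu hv
  exact three_le_card_targets_of_P htgt hpc.symm hqc.symm hpq hcX hpX hqX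
    hcC.1 hcC.2 hpC.1 hpC.2 hqC.1 hqC.2

/-- **THREE DEFECTS GIVE THREE TARGETS** (loop regime). -/
theorem three_targets_of_three_bad_P (hn : (gr N).card = 9) (h : SeriesPair N b b')
    {e f : α} (he : e ∈ gr N) (hf : f ∈ gr N) (hef : e ≠ f) (heb : e ≠ b) (heb' : e ≠ b') (hfb : f ≠ b) (hfb' : f ≠ b')
    (he1 : ∀ y ∈ ((((gr N).erase b).erase b').erase f).erase e, rk N {e, y} = 2)
    (hf1 : ∀ y ∈ ((((gr N).erase b).erase b').erase f).erase e, rk N {f, y} = 2)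
    (hfc : ∀ y ∈ ((((gr N).erase b).erase b').erase f).erase e, rk N (((((gr N).erase b).erase b').erase f).erase y) = 4)
    (hX : rk N (((((gr N).erase b).erase b').erase f).erase e) = 4) (hef2 : rk N {e, f} = 2)
    {P : Finset α → Prop} [DecidablePred P] {T : Finset (Finset α)}
    (hP : ∀ W ∈ (d0DON N b' e f).filter P, ¬ (rk N (insert f ((W.erase b).erase e)) = 3 ∧
      rk N (insert e (((((gr N).erase b).erase b').erase f).erase e \ (W.erase b).erase e)) = 4))
    (htgt : ∀ x ∈ ((((gr N).erase b).erase b').erase f).erase e, rk N {e, f, x} = 3 →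
      rk N ((((((gr N).erase b).erase b').erase f).erase e).erase x) = 4 → insert b {e, f, x} ∈ T)
    {W₁ W₂ W₃ : Finset α} (hW₁ : W₁ ∈ (d0DON N b' e f).filter P)
    (hW₂ : W₂ ∈ (d0DON N b' e f).filter P)
    (hW₃ : W₃ ∈ (d0DON N b' e f).filter P)
    (hW12 : W₁ ≠ W₂) (hW13 : W₁ ≠ W₃) (hW23 : W₂ ≠ W₃) :
    3 ≤ T.card := by
  have hbadC := defect_data_of_P hn h he hf hef heb heb' hfb hfb' he1 hf1 hX hef2 hP
  obtain ⟨hπX₁, -, -, -, -, -, x₁, hx₁π, hx₁C⟩ := hbadC W₁ hW₁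
  obtain ⟨hπX₂, -, -, -, -, -, x₂, hx₂π, hx₂C⟩ := hbadC W₂ hW₂
  obtain ⟨hπX₃, -, -, -, -, -, x₃, hx₃π, hx₃C⟩ := hbadC W₃ hW₃
  by_cases h12 : x₁ = x₂
  · subst h12
    exact three_targets_of_shared hn h he hf hef heb heb' hfb hfb' he1 hf1 hfc hX hef2 hP htgt hW₁ hW₂ hW₃ hW12 hW13
      hW23 hx₁π hx₂π hx₁C hx₃π hx₃C
  by_cases h13 : x₁ = x₃
  · subst h13
    exact three_targets_of_shared hn h he hf hef heb heb' hfb hfb' he1 hf1 hfc hX hef2 hP htgt hW₁ hW₃ hW₂ hW13 hW12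
      hW23.symm hx₁π hx₃π hx₁C hx₂π hx₂C
  by_cases h23 : x₂ = x₃
  · subst h23
    exact three_targets_of_shared hn h he hf hef heb heb' hfb hfb' he1 hf1 hfc hX hef2 hP htgt hW₂ hW₃ hW₁ hW23
      hW12.symm hW13.symm hx₂π hx₃π hx₂C hx₁π hx₁C
  exact three_le_card_targets_of_P htgt h12 h13 h23 (hπX₁ hx₁π) (hπX₂ hx₂π)
    (hπX₃ hx₃π) hx₁C.1 hx₁C.2 hx₂C.1 hx₂C.2 hx₃C.1 hx₃C.2

/-- **AT MOST THREE DEFECTS ARE AT MOST THE C-POINT TARGETS** (loop regime). -/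
theorem card_bad_le_targets_of_card_le_three_P (hn : (gr N).card = 9) (h : SeriesPair N b b')
    {e f : α} (he : e ∈ gr N) (hf : f ∈ gr N) (hef : e ≠ f) (heb : e ≠ b) (heb' : e ≠ b') (hfb : f ≠ b) (hfb' : f ≠ b')
    (he1 : ∀ y ∈ ((((gr N).erase b).erase b').erase f).erase e, rk N {e, y} = 2)
    (hf1 : ∀ y ∈ ((((gr N).erase b).erase b').erase f).erase e, rk N {f, y} = 2)
    (hfc : ∀ y ∈ ((((gr N).erase b).erase b').erase f).erase e, rk N (((((gr N).erase b).erase b').erase f).erase y) = 4)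
    (hX : rk N (((((gr N).erase b).erase b').erase f).erase e) = 4) (hef2 : rk N {e, f} = 2)
    {P : Finset α → Prop} [DecidablePred P] {T : Finset (Finset α)}
    (hP : ∀ W ∈ (d0DON N b' e f).filter P, ¬ (rk N (insert f ((W.erase b).erase e)) = 3 ∧
      rk N (insert e (((((gr N).erase b).erase b').erase f).erase e \ (W.erase b).erase e)) = 4))
    (htgt : ∀ x ∈ ((((gr N).erase b).erase b').erase f).erase e, rk N {e, f, x} = 3 →
      rk N ((((((gr N).erase b).erase b').erase f).erase e).erase x) = 4 → insert b {e, f, x} ∈ T)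
    (h3 : ((d0DON N b' e f).filter P).card ≤ 3) :
    ((d0DON N b' e f).filter P).card ≤
      T.card := by
  by_cases h2 : ((d0DON N b' e f).filter P).card ≤ 2
  · exact card_bad_le_targets_of_card_le_two_P hn h he hf hef heb heb' hfb hfb' he1 hf1 hfc hX hef2 hP htgt h2
  · have hcard3 : ((d0DON N b' e f).filter P).card = 3 := by omega
    obtain ⟨W₁, W₂, W₃, hW12, hW13, hW23, hset⟩ := card_eq_three.1 hcard3
    have hW₁ : W₁ ∈ (d0DON N b' e f).filter P := by
      rw [hset]; exact mem_insert_self _ _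
    have hW₂ : W₂ ∈ (d0DON N b' e f).filter P := by
      rw [hset]; exact mem_insert_of_mem (mem_insert_self _ _)
    have hW₃ : W₃ ∈ (d0DON N b' e f).filter P := by
      rw [hset]; exact mem_insert_of_mem (mem_insert_of_mem (mem_singleton_self _))
    have := three_targets_of_three_bad_P hn h he hf hef heb heb' hfb hfb' he1 hf1 hfc hX hef2 hP htgt hW₁ hW₂ hW₃ hW12 hW13
      hW23
    omega

end StarSharpDefectC

end PercRepro.Cogirth
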